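import Mathlib
import Summits.PneNP.PneNP.Theses.RamseyUncertifiable
import Literature.Computability.MetaComplexity.ProofSystems
import Literature.Computability.MetaComplexity.ProofSystemsProofs

/-!
# Crux `RamseyNotNP` (stmt-PneNP-9814) — ideator 5, round 2: the OPTIMALITY CUT

First lemma(s) of the crux idea card `optimality-cut` (folder `idea-optimality-cut.md`).
X := `RamseyNotNP` = "RAMSEY₂ ∉ NP" quantifies over ALL polynomial-time verifiers. The lever is the
(weak-)simulation preorder of Cook–Reckhow proof systems for the language RAMSEY₂ ("Ramsey
certifiers") and its maximal elements:

* `ramseyNotNP_of_hard_opt` — THE CUT: for any Ramsey certifier `Q`, `Hard Q ∧ Opt Q → X`, where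
  `Hard Q` = "`Q` is not polynomially bounded" (a lower bound for ONE proof system) and `Opt Q` =
  "`Q` weakly simulates every Ramsey certifier" (OPTIMALITY of `Q`); neither conjunct alone implies
  `coNP ≠ NP`.
* `ramseyNotNP_iff_forall_opt_hard` — the unconditional DICHOTOMY: X ⟺ every optimal Ramsey
  certifier (if any exists) is hard. (A p-bounded certifier is automatically optimal.)
* `FCT Q` — the feasible-certification thesis for `Q` ("if Ramsey-ness is NP-certifiable at all, `Q`
  certifies it with polynomial overhead"); `fct_of_opt : Opt Q → FCT Q`, `fct_of_optFam`, and
  `ramseyNotNP_iff_hard_of_fct : FCT Q → (X ↔ Hard Q)` — under the thesis the crux IS a single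
  proof-complexity lower bound.
* `OptFam Q` — the instance-language form (cf. the disprover's §7 instance form of X): every NP
  family of (codes of) Ramsey graphs is `Q`-easy; `ramseyNotNP_of_hard_optFam`.

Intended instantiation (card): `Q := P_T`, the strong proof system of a bounded-arithmetic theory
`T` (T = S¹₂ ↦ EF by Cook's correspondence, Krajíček 2019 Thm. 12.4.2; T = APC₂/T²₂ ↦ fragments of
G₂), for which `Opt P_T` is the thesis "every feasible certification of Ramsey-ness has a
T-formalisable soundness proof". `P_T` as a `List Bool → List Bool → Bool` needs a proof calculus
with proof size for `Literature.Computability.MetaComplexity.S2` — a definition request, not here.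
Everything below is sorry-free over existing declarations.
-/

namespace Summit.PneNP.PneNP.Cruxes.RamseyNotNP.Ideator5

open Literature.Computability.Complexity Literature.Computability.Complexity.Nondeterministic
open Literature.Computability.MetaComplexity
open Summit.PneNP.PneNP.Theses.RamseyUncertifiable

/-- RAMSEY₂ as a language of adjacency codes (the crux's set-builder, verbatim). -/
def ramseyLang : Language Bool :=
  encodingGraph.toLanguage {p : Σ n, SimpleGraph (Fin n) |
    p.2.CliqueFree (Nat.clog 2 (p.1 ^ 2)) ∧ p.2ᶜ.CliqueFree (Nat.clog 2 (p.1 ^ 2))}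

/-- Read-back: the crux is `ramseyLang ∉ NP`, definitionally. -/
theorem ramseyNotNP_iff : RamseyNotNP ↔ ramseyLang ∉ NP := Iff.rfl

/-- `Hard Q`: the proof system `Q` is NOT polynomially bounded. For a Ramsey certifier this is a
lower bound for ONE verifier: infinitely often some Ramsey graph has no short `Q`-certificate. -/
def Hard (Q : List Bool → List Bool → Bool) : Prop := ¬ IsPolyBounded Q

/-- `Opt Q`: `Q` weakly simulates every Cook–Reckhow proof system for RAMSEY₂ — `Q` is an OPTIMAL
Ramsey certifier (Krajíček 2019, Problem 1.5.5 / Ch. 21, for the language RAMSEY₂ instead of TAUT). -/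
def Opt (Q : List Bool → List Bool → Bool) : Prop :=
  ∀ W, IsProofSystemFor W ramseyLang → Simulates Q W

/-- `OptFam Q` (instance-language form): every NP family of codes of Ramsey graphs is `Q`-easy —
its members have `Q`-certificates of length polynomial in the member. -/
def OptFam (Q : List Bool → List Bool → Bool) : Prop :=
  ∀ F : Language Bool, F ∈ NP → F ≤ ramseyLang →
    ∃ p : Polynomial ℕ, ∀ x ∈ F, ∃ π : List Bool, π.length ≤ p.eval x.length ∧ Q x π = true

/-- `FCT Q` — the feasible-certification thesis for `Q`: if RAMSEY₂ is NP-certifiable at all, then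
`Q` is polynomially bounded (certifies every Ramsey graph with polynomial overhead). -/
def FCT (Q : List Bool → List Bool → Bool) : Prop := ramseyLang ∈ NP → IsPolyBounded Q

/-- **THE CUT.** A hard optimal Ramsey certifier proves the crux: `Hard Q → Opt Q → RamseyNotNP`.
(If RAMSEY₂ ∈ NP, Cook–Reckhow gives a p-bounded certifier `W`; `Q` simulates `W`, so `Q` is
p-bounded — contradiction.) Neither hypothesis alone implies `coNP ≠ NP`. -/
theorem ramseyNotNP_of_hard_opt {Q : List Bool → List Bool → Bool}
    (hQ : IsProofSystemFor Q ramseyLang) (hH : Hard Q) (hO : Opt Q) : RamseyNotNP := by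
  intro hNP
  obtain ⟨W, hW, hWb⟩ := (hasPolyBoundedProofSystem_iff_mem_NP_holds (L := ramseyLang)).2 hNP
  exact hH (IsPolyBounded.of_simulates_holds (hO W hW) hWb hQ hW)

/-- The converse half is free: the crux makes EVERY Ramsey certifier hard. -/
theorem hard_of_ramseyNotNP (hX : RamseyNotNP) {Q : List Bool → List Bool → Bool}
    (hQ : IsProofSystemFor Q ramseyLang) : Hard Q :=
  fun hb => hX ((hasPolyBoundedProofSystem_iff_mem_NP_holds (L := ramseyLang)).1 ⟨Q, hQ, hb⟩)

/-- Evaluation of an `ℕ`-polynomial is monotone in the argument. -/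
private theorem eval_mono (r : Polynomial ℕ) {a b : ℕ} (hab : a ≤ b) : r.eval a ≤ r.eval b := by
  rw [Polynomial.eval_eq_sum_range, Polynomial.eval_eq_sum_range]
  exact Finset.sum_le_sum fun i _ => Nat.mul_le_mul_left _ (Nat.pow_le_pow_left hab i)

/-- A polynomially bounded Ramsey certifier is optimal (it simulates everything: any `W`-proof of
`x` shows `x ∈ RAMSEY₂`, which has a short proof in the p-bounded system). -/
theorem opt_of_isPolyBounded {Q : List Bool → List Bool → Bool}
    (hQ : IsProofSystemFor Q ramseyLang) (hb : IsPolyBounded Q) : Opt Q := by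
  intro W hW
  obtain ⟨p, hp⟩ := hb
  refine ⟨p, fun x π hπ => ?_⟩
  have hx : x ∈ ramseyLang := (hW.2 x).2 ⟨π, hπ⟩
  obtain ⟨π₀, hπ₀⟩ := (hQ.2 x).1 hx
  obtain ⟨π', hlen, hacc⟩ := hp x π₀ hπ₀
  exact ⟨π', hlen.trans (eval_mono p (Nat.le_add_right _ _)), hacc⟩

/-- **THE DICHOTOMY (unconditional).** The crux is equivalent to: every OPTIMAL Ramsey certifier
is hard. The universal quantifier over all verifiers in X is replaced by a quantifier over the
maximal elements of the simulation preorder (a possibly empty set: whether RAMSEY₂ has an optimal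
proof system is open; by Cook–Krajíček it has one with ONE BIT of advice per length). -/
theorem ramseyNotNP_iff_forall_opt_hard :
    RamseyNotNP ↔ ∀ Q, IsProofSystemFor Q ramseyLang → Opt Q → Hard Q := by
  constructor
  · exact fun hX Q hQ _ => hard_of_ramseyNotNP hX hQ
  · intro h hNP
    obtain ⟨W, hW, hWb⟩ := (hasPolyBoundedProofSystem_iff_mem_NP_holds (L := ramseyLang)).2 hNP
    exact h W hW (opt_of_isPolyBounded hW hWb) hWb

/-- Optimality implies the feasible-certification thesis. -/
theorem fct_of_opt {Q : List Bool → List Bool → Bool}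
    (hQ : IsProofSystemFor Q ramseyLang) (hO : Opt Q) : FCT Q := by
  intro hNP
  obtain ⟨W, hW, hWb⟩ := (hasPolyBoundedProofSystem_iff_mem_NP_holds (L := ramseyLang)).2 hNP
  exact IsPolyBounded.of_simulates_holds (hO W hW) hWb hQ hW

/-- The instance-language form implies the thesis (take the family `F := RAMSEY₂` itself). -/
theorem fct_of_optFam {Q : List Bool → List Bool → Bool}
    (hQ : IsProofSystemFor Q ramseyLang) (hO : OptFam Q) : FCT Q := by
  intro hNP
  obtain ⟨p, hp⟩ := hO ramseyLang hNP le_rfl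
  exact ⟨p, fun x π hπ => hp x ((hQ.2 x).2 ⟨π, hπ⟩)⟩

/-- The cut in instance language: a hard certifier for which every NP family of Ramsey graphs is
easy proves the crux. -/
theorem ramseyNotNP_of_hard_optFam {Q : List Bool → List Bool → Bool}
    (hQ : IsProofSystemFor Q ramseyLang) (hH : Hard Q) (hO : OptFam Q) : RamseyNotNP :=
  fun hNP => hH (fct_of_optFam hQ hO hNP)

/-- **Under the thesis, the crux IS one lower bound**: `FCT Q → (RamseyNotNP ↔ Hard Q)`. -/
theorem ramseyNotNP_iff_hard_of_fct {Q : List Bool → List Bool → Bool}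
    (hQ : IsProofSystemFor Q ramseyLang) (hF : FCT Q) : RamseyNotNP ↔ Hard Q :=
  ⟨fun hX => hard_of_ramseyNotNP hX hQ, fun hH hNP => hH (hF hNP)⟩

/-- Logical status of the thesis, stated honestly: `FCT Q` is implied by the crux (vacuously) … -/
theorem fct_of_ramseyNotNP (hX : RamseyNotNP) (Q : List Bool → List Bool → Bool) : FCT Q :=
  fun hNP => (hX hNP).elim

/-- … and `FCT Q` is exactly "X ∨ Q is p-bounded"; the CONTENT of the card is the choice of `Q`
(the strong proof system of a theory) for which the right disjunct is the thesis' real claim. -/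
theorem fct_iff_or (Q : List Bool → List Bool → Bool) : FCT Q ↔ RamseyNotNP ∨ IsPolyBounded Q := by
  unfold FCT
  constructor
  · intro h
    by_cases hX : RamseyNotNP
    · exact Or.inl hX
    · exact Or.inr (h (not_not.1 hX))
  · rintro (hX | hb) hNP
    · exact (hX hNP).elim
    · exact hb

end Summit.PneNP.PneNP.Cruxes.RamseyNotNP.Ideator5
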